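import Summits.CriticalPhenomena.Ising3DConformalLimit.Theorems.EnergyNotSigmaSquaredGapForcesFarMergingScreeningAnnularGlue
import Summits.CriticalPhenomena.Ising3DConformalLimit.Theorems.EnergyNotSigmaSquaredGapForcesFarMergingScreeningFarSource
import Summits.CriticalPhenomena.Ising3DConformalLimit.Theorems.EnergyNotSigmaSquaredGapForcesFarMergingScreeningNearSourceReduction
import Summits.CriticalPhenomena.Ising3DConformalLimit.Theorems.EnergyNotSigmaSquaredGapForcesFarMergingScreeningAnnularSplit
import Summits.CriticalPhenomena.Ising3DConformalLimit.Theorems.GapForcesFarMerging.Negative.NotRP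

/-!
# Line `screening-form-lemma-a1` — checked skeleton for crux `GapForcesFarMerging`
# (item stmt-CriticalPhenomena-4468, route `EnergyNotSigmaSquared`, rank 2) — LEAD'S RESHAPE v3.3 (seat a1, 2026-08-17T05:10Z):
# the ANNULAR (untilted) far end, every open stub ONE analytic statement

Crux (by name): `Summit.CriticalPhenomena.Ising3DConformalLimit.Theses.EnergyNotSigmaSquared.GapForcesFarMerging`
`= EnergyGapPowerLaw → FarMergingShape cc2 (criticalCorr 3 4)` (`Negative.SoftShapes.crux_iff`, `Iff.rfl`).

History. v1 (planner + lead gen-1): 7 stubs, closed modulo `Floors` (S5) and `stub_farScreening` (S6) (certificate p100284).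
v2 (lead c2): crux closed modulo `Floors ∧ HazardRelocation ∧ Unpin` (certificate p121744). v3/v3.1 (lead a1): the far end
re-routed through UNTILTED ANNULAR screening — no floors, no doubling windows, no ratio-form relocation:
`stub_decayDyadic` LANDED p138654, `stub_opaqueStep` LANDED p138973, exact far end + glue LANDED p140843
(`gapForcesFarMerging_of_annular : AnnularDomination → NearSourceInsensitivity → FarSourceInsensitivity → GapForcesFarMerging`,
`Theorems/…ScreeningAnnularGlue.lean`) — the crux closed modulo `AD ∧ NS ∧ FS`.
v3.2: the two relocation currencies REPLACED by the antecedents of their landed reductions. v3.3 (this file): the core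
`AnnularDomination` SPLIT (landed `annularDomination_of_blocking_untilt`, …ScreeningAnnularSplit.lean) into TILTED BLOCKING
CONTROL (B, the one statement with no analogue in print) and UN-TILTING (H, Harris/mixing type), so that every open stub is a
single analytic statement about ONE sourced critical current / depleted box two-point functions on `ℤ³`:

```
GAP ─S1→ OnePinchGap ─S2dy→ DecayDyadic ─S3′→ OpaqueStepIO ─[stub_tiltedBlocking]→ tilted free annular hazard
    ─[stub_untilt]→ untilted annular drop (pinned probe)  (B → H → AD: …ScreeningAnnularSplit.lean)
    ─[stub_sourceOscillation ⇒ NS (p139592)]→ deep-source probe ─[stub_strandMixing + stub_probeOscillation ⇒ FS (p141457)]→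
    far ends at aspect ≤ 2^(A+3) ─antitonicity (p140843)→ FarScreeningIO ─S7→ FarMerging
```
* `AnnularDomination` = `stub_tiltedBlocking (B) ∧ stub_untilt (H)` (XL, OPEN, the core — held by the lead). By the landed drop identity
  `screening_drop_eq_defect` (…FloorsAux.lean) the octave drop is the TILTED mean of
  `re-entrance drop + S(T₁)/S(C_(2^k))·H(T₂ | T₁)`, `T₁ = C_(2^(k+1)) ∩ Λ_(2^k)`, `T₂ = annPiece k` (the hazard of the annular
  piece for the probe system CONFINED off the inner cluster), while the conclusion `1 - annScreen ≥ μ` is the UNtilted,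
  UNconfined hazard `P[dn ∈ C] + E[𝟙·H(T₂ | ∅)]`. Lead's exact enumeration (Cruxes/…/AD-ANALYSIS.md; 3×3, 2×5, 2×2×2 Ising
  graphs): the screening ratio is NEITHER subadditive (`S(T₁)+S(T₂) ≤ 1+S(T₁∪T₂)` fails: −0.04 at β=.44, −0.68 at β=1.1) NOR
  supermultiplicative, and the confined/free hazard ratio `H(T₂|T₁)S₁/H(T₂|∅)` is unbounded (36 at β=1.1) — so AD does NOT
  follow from positive association + algebra even if the cluster were FKG (it is not: lead c1's 4-cycle); AD is irreducibly a
  statement about the tilted joint geometry. (B): under the screening tilt `W_k = 𝟙S(C_(2^k))` a drop `c` of the ladder forces a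
  tilted FREE annular hazard `E[W_k(1 − annWeight_k)] ≥ ν(c)E[W_k]` (anti-cooperative-blocking + re-entrance control; no analogue
  in print). (H): a tilted free annular hazard `≥ ν` forces an untilted one `≥ μ(ν)` (Harris' inequality would give `μ = ν` under
  positive association, which fails for the duplicated cluster — lead c1; qualitatively an inner/outer mixing statement under
  conditioning, ADC21 §6 type). No proof technology for sourced critical currents on `ℤ³` exists in print (grounder g13-42).
* `stub_sourceOscillation` (L, OPEN): near-SOURCE oscillation of the screening ratio of a deterministic annular obstacle,
  averaged over a finite family `F` of deep sources `2^(k-j)u` against the pinned source `e₂` (additive, `j` free) — the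
  antecedent of the landed `nearSource_of_screeningOscillation` (p139592); ADC21 Thm 6.4 / (6.16) shape (`d = 4` in print;
  `d = 3` only non-uniform: Panis 2025 Thm 2.4).
* `stub_strandMixing` (L, OPEN): total-variation insensitivity, uniform in the octave `k`, of the law of the explored cluster
  `C_(2^(k+1))(0)` under the one-strand law to the far source beyond aspect `2^A` — the UNIFORM form of Panis' sourced IIC
  (PTRF 194 (2025) Thm 3.1; tree named fact `currentIIC_limit_exists` = the non-uniform limit); antecedent (M) of the landed
  `farSource_of_strandMixing_probeOscillation` (p141457).
* `stub_probeOscillation` (L, OPEN): far-END oscillation of the screening ratio of a deterministic annular obstacle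
  (`S_(a,dn M')(T) ≤ S_(a,dn M)(T) + ε` beyond aspect `2^A`); antecedent (O) of the same reduction; ADC21 (6.16) shape.
The one-point density `P[dn M ∈ C(0)] → 0` needed on the way is PROVED (p141457, `farSrc_real_openConn_eq` + `dnDensity_eventually_lt`).

## Disproof used (`Cruxes/GapForcesFarMerging/Disproof.lean` v13; landed `Theorems/…/Negative/*`)
* `gapForcesFarMerging_false_without_model` / `gapShape_not_determined_by_bulk`: honoured — the model enters at the five stubs
  (current-level statements), never as a package consequence; RP only through the landed `singlePinchLawShape_of_gap`.
* gen-1 `cruxWithoutKappaPos_iff`: `0 < κ` is consumed in `stub_opaqueStep`. Seat c3's RP–GFF barrier: not applicable (no stub is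
  an RP/GAP consequence). No stub is an instance of a landed Negative lemma; no `-- Targets` entry addresses these stubs (v13
  targets the rp-unpinch line only).
-/

noncomputable section

namespace Summit.CriticalPhenomena.Ising3DConformalLimit.Cruxes.GapForcesFarMerging.ScreeningFormLemmaA1

open scoped symmDiff ENNReal
open MeasureTheory Filter Finset
open Literature.Probability.LatticeModels Literature.Probability.Percolation
open Summit.CriticalPhenomena.Ising3DConformalLimit.Theses.EnergyNotSigmaSquared
open Summit.CriticalPhenomena.Ising3DConformalLimit.Theorems.GapForcesFarMerging.Negative
  (e₁ e₂ cc2 xR up dn FarMergingShape SinglePinchLawShape)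
open Summit.CriticalPhenomena.Ising3DConformalLimit.GapForcesFarMergingScreening
open Summit.CriticalPhenomena.Ising3DConformalLimit.EnergyNotSigmaSquaredGapForcesFarMerging

/-! ## The five registered stubs of v3.3 (the only `sorry`s of the file) -/

/-- **B — TILTED BLOCKING CONTROL** (the core; open; held by the lead): at an opaque octave (bulk) step the annular (outer)
piece ALONE cuts a free probe with tilted probability `≥ ν(c)` — the drop is not entirely cooperative blocking / re-entrance. [folklore] -/
theorem stub_tiltedBlocking : ∀ c : ℝ, 0 < c → ∃ ν : ℝ, 0 < ν ∧ (∀ᶠ k : ℕ in atTop, ∀ K : ℕ, k < K → ∀ᶠ n : ℕ in atTop, (0 < pinchScreen n (2 ^ k) (2 ^ (K + 3)) ∧ pinchScreen n (2 ^ (k + 1)) (2 ^ (K + 3)) ≤ (1 - c) * pinchScreen n (2 ^ k) (2 ^ (K + 3))) → ν * pinchScreen n (2 ^ k) (2 ^ (K + 3)) ≤ ∫ ω, screenWeight n (2 ^ k) 0 e₂ (dn (2 ^ (K + 3))) ω * (1 - annWeight n k 0 e₂ (dn (2 ^ (K + 3))) ω) ∂(sourcedDoubleCurrentLaw 3 n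 (criticalBeta 3) ({0} ∆ {up (2 ^ (K + 3))}) ∅)) ∧ (∀ᶠ K : ℕ in atTop, ∀ᶠ n : ℕ in atTop, (0 < pinchScreen n (2 ^ K) (2 ^ (K + 3)) ∧ pinchScreen n n (2 ^ (K + 3)) ≤ (1 - c) * pinchScreen n (2 ^ K) (2 ^ (K + 3))) → ν * pinchScreen n (2 ^ K) (2 ^ (K + 3)) ≤ ∫ ω, screenWeight n (2 ^ K) 0 e₂ (dn (2 ^ (K + 3))) ω * (1 - outerWeight n K 0 e₂ (dn (2 ^ (K + 3))) ω) ∂(sourcedDoubleCurrentLaw 3 n (criticalBeta 3) ({0} ∆ {up (2 ^ (K + 3))}) ∅)) := by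
  sorry

/-- **H — UN-TILTING** (open; Harris/mixing type): the screening tilt cannot inflate a small untilted annular (outer) hazard
into a large tilted one. [cite: AizenmanDuminilCopinAnnals2021, Theorem 6.4] -/
theorem stub_untilt : ∀ ν : ℝ, 0 < ν → ∃ μ : ℝ, 0 < μ ∧ (∀ᶠ k : ℕ in atTop, ∀ K : ℕ, k < K → ∀ᶠ n : ℕ in atTop, 0 < pinchScreen n (2 ^ k) (2 ^ (K + 3)) → ν * pinchScreen n (2 ^ k) (2 ^ (K + 3)) ≤ ∫ ω, screenWeight n (2 ^ k) 0 e₂ (dn (2 ^ (K + 3))) ω * (1 - annWeight n k 0 e₂ (dn (2 ^ (K + 3))) ω) ∂(sourcedDoubleCurrentLaw 3 n (criticalBeta 3) ({0} ∆ {up (2 ^ (K + 3))}) ∅) → annScreen n k 0 (up (2 ^ (K + 3))) e₂ (dn (2 ^ (K + 3))) ≤ 1 - μ) ∧ (∀ᶠ K : ℕ in atTop, ∀ᶠ n : ℕ in atTop, 0 < pinchScreen n (2 ^ K) (2 ^ (K + 3)) → ν * pinchScreen n (2 ^ K) (2 ^ (K + 3)) ≤ ∫ ω, screenWeight n (2 ^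 K) 0 e₂ (dn (2 ^ (K + 3))) ω * (1 - outerWeight n K 0 e₂ (dn (2 ^ (K + 3))) ω) ∂(sourcedDoubleCurrentLaw 3 n (criticalBeta 3) ({0} ∆ {up (2 ^ (K + 3))}) ∅) → outerScreen n K 0 (up (2 ^ (K + 3))) e₂ (dn (2 ^ (K + 3))) ≤ 1 - μ) := by
  sorry

/-- **NS-osc — NEAR-SOURCE OSCILLATION of the screening ratio of a far deterministic obstacle** (open in `d = 3`; antecedent of
the landed reduction `nearSource_of_screeningOscillation`, p139592). [cite: AizenmanDuminilCopinAnnals2021, Theorem 6.4] -/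
theorem stub_sourceOscillation : ∀ μ : ℝ, 0 < μ → ∃ j : ℕ, ∃ F : Finset (Site 3), F.Nonempty ∧ (∀ u ∈ F, u 2 ≠ 0) ∧ (∀ᶠ k : ℕ in atTop, ∀ K : ℕ, k < K → ∀ᶠ n : ℕ in atTop, ∀ T : Finset (Site 3), T ⊆ box 3 (2 ^ (k + 1)) \ box 3 (2 ^ k) → ∑ u ∈ F, screening n T (deepSource k j u) (dn (2 ^ (K + 3))) ≤ #F * (screening n T e₂ (dn (2 ^ (K + 3))) + μ / 2)) ∧ (∀ᶠ K : ℕ in atTop, ∀ᶠ n : ℕ in atTop, ∀ T : Finset (Site 3), T ⊆ box 3 n \ box 3 (2 ^ K) → dn (2 ^ (K + 3)) ∉ T → ∑ u ∈ F, screening n T (deepSource K j u) (dn (2 ^ (K + 3))) ≤ #F * (screening n T e₂ (dn (2 ^ (K + 3))) + μ / 2)) := by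
  sorry

/-- **M — STRAND MIXING, uniform in the octave** (open in `d = 3`; antecedent (M) of the landed reduction
`farSource_of_strandMixing_probeOscillation`, p141457; the uniform form of Panis' sourced IIC). [cite: Panis2025, Theorem 3.1] -/
theorem stub_strandMixing : ∀ ε : ℝ, 0 < ε → ∃ A : ℕ, ∀ᶠ k : ℕ in atTop, ∀ K K' : ℕ, k + A ≤ K → k + A ≤ K' → ∀ᶠ n : ℕ in atTop, ∀ f : Finset (Site 3) → ℝ, (∀ C, 0 ≤ f C) → (∀ C, f C ≤ 1) → ∫ ω, f (innerCluster (2 ^ (k + 1)) 0 ω) ∂(sourcedDoubleCurrentLaw 3 n (criticalBeta 3) ({0} ∆ {up (2 ^ (K' + 3))}) ∅) ≤ ∫ ω, f (innerCluster (2 ^ (k + 1)) 0 ω) ∂(sourcedDoubleCurrentLaw 3 n (criticalBeta 3) ({0} ∆ {up (2 ^ (K + 3))}) ∅) + ε := by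
  sorry

/-- **O — FAR-END OSCILLATION of the screening ratio of a deterministic annular obstacle** (open in `d = 3`; antecedent (O) of
the landed reduction `farSource_of_strandMixing_probeOscillation`, p141457). [cite: AizenmanDuminilCopinAnnals2021, Theorem 6.4] -/
theorem stub_probeOscillation : ∀ ε : ℝ, 0 < ε → ∀ c : ℕ, ∃ A : ℕ, ∀ᶠ k : ℕ in atTop, ∀ K K' : ℕ, k + A ≤ K → k + A ≤ K' → ∀ᶠ n : ℕ in atTop, ∀ T : Finset (Site 3), T ⊆ box 3 (2 ^ (k + 1)) \ box 3 (2 ^ k) → ∀ a ∈ box 3 (2 ^ (k + c)) \ T, screening n T a (dn (2 ^ (K' + 3))) ≤ screening n T a (dn (2 ^ (K + 3))) + ε := by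
  sorry

/-! ## Composition (sorry-free glue, all landed): the stubs conclude the crux BY NAME -/

/-- `AnnularDomination` from tilted blocking control and un-tilting (landed split, …ScreeningAnnularSplit.lean). [folklore] -/
theorem annularDomination_of_stubs : AnnularDomination :=
  annularDomination_of_blocking_untilt stub_tiltedBlocking stub_untilt

/-- `NearSourceInsensitivity` from the near-source oscillation stub (landed reduction p139592). [folklore] -/
theorem nearSource_of_stub : NearSourceInsensitivity :=
  nearSource_of_screeningOscillation stub_sourceOscillation

/-- `FarSourceInsensitivity` from strand mixing and far-end oscillation (landed reduction p141457). [folklore] -/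
theorem farSource_of_stubs : FarSourceInsensitivity :=
  farSource_of_strandMixing_probeOscillation stub_strandMixing stub_probeOscillation

/-- **The skeleton theorem**: the crux BY NAME from the four stubs through the landed split, reductions and annular certificate
`gapForcesFarMerging_of_annular` (p140843). [folklore] -/
theorem GapForcesFarMerging_of :
    Summit.CriticalPhenomena.Ising3DConformalLimit.Theses.EnergyNotSigmaSquared.GapForcesFarMerging :=
  gapForcesFarMerging_of_annular' annularDomination_of_stubs nearSource_of_stub farSource_of_stubs

/-- The logic of the line with the stubs as hypotheses (no `sorry` in its cone): `B → H → NS-osc → M → O → crux`. [folklore] -/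
theorem line_closes_v33 (hB : ∀ c : ℝ, 0 < c → ∃ ν : ℝ, 0 < ν ∧ (∀ᶠ k : ℕ in atTop, ∀ K : ℕ, k < K → ∀ᶠ n : ℕ in atTop, (0 < pinchScreen n (2 ^ k) (2 ^ (K + 3)) ∧ pinchScreen n (2 ^ (k + 1)) (2 ^ (K + 3)) ≤ (1 - c) * pinchScreen n (2 ^ k) (2 ^ (K + 3))) → ν * pinchScreen n (2 ^ k) (2 ^ (K + 3)) ≤ ∫ ω, screenWeight n (2 ^ k) 0 e₂ (dn (2 ^ (K + 3))) ω * (1 - annWeight n k 0 e₂ (dn (2 ^ (K + 3))) ω) ∂(sourcedDoubleCurrentLaw 3 n (criticalBeta 3) ({0} ∆ {up (2 ^ (K + 3))}) ∅)) ∧ (∀ᶠ K : ℕ in atTop, ∀ᶠ n : ℕ in atTop, (0 < pinchScreen n (2 ^ K) (2 ^ (K + 3)) ∧ pinchScreen n n (2 ^ (K + 3)) ≤ (1 - c) * pinchScreen n (2 ^ K) (2 ^ (K + 3))) → ν * pinchScreen n (2 ^ K) (2 ^ (K + 3)) ≤ ∫ ω, screenWeight n (2 ^ K) 0 e₂ (dn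 (2 ^ (K + 3))) ω * (1 - outerWeight n K 0 e₂ (dn (2 ^ (K + 3))) ω) ∂(sourcedDoubleCurrentLaw 3 n (criticalBeta 3) ({0} ∆ {up (2 ^ (K + 3))}) ∅)))
    (hH : ∀ ν : ℝ, 0 < ν → ∃ μ : ℝ, 0 < μ ∧ (∀ᶠ k : ℕ in atTop, ∀ K : ℕ, k < K → ∀ᶠ n : ℕ in atTop, 0 < pinchScreen n (2 ^ k) (2 ^ (K + 3)) → ν * pinchScreen n (2 ^ k) (2 ^ (K + 3)) ≤ ∫ ω, screenWeight n (2 ^ k) 0 e₂ (dn (2 ^ (K + 3))) ω * (1 - annWeight n k 0 e₂ (dn (2 ^ (K + 3))) ω) ∂(sourcedDoubleCurrentLaw 3 n (criticalBeta 3) ({0} ∆ {up (2 ^ (K + 3))}) ∅) → annScreen n k 0 (up (2 ^ (K + 3))) e₂ (dn (2 ^ (K + 3))) ≤ 1 - μ) ∧ (∀ᶠ K : ℕ in atTop, ∀ᶠ n : ℕ in atTop, 0 < pinchScreen n (2 ^ K) (2 ^ (K + 3)) → ν * pinchScreen n (2 ^ K) (2 ^ (K + 3)) ≤ ∫ ω,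 screenWeight n (2 ^ K) 0 e₂ (dn (2 ^ (K + 3))) ω * (1 - outerWeight n K 0 e₂ (dn (2 ^ (K + 3))) ω) ∂(sourcedDoubleCurrentLaw 3 n (criticalBeta 3) ({0} ∆ {up (2 ^ (K + 3))}) ∅) → outerScreen n K 0 (up (2 ^ (K + 3))) e₂ (dn (2 ^ (K + 3))) ≤ 1 - μ)) (hNS : ∀ μ : ℝ, 0 < μ → ∃ j : ℕ, ∃ F : Finset (Site 3), F.Nonempty ∧ (∀ u ∈ F, u 2 ≠ 0) ∧ (∀ᶠ k : ℕ in atTop, ∀ K : ℕ, k < K → ∀ᶠ n : ℕ in atTop, ∀ T : Finset (Site 3), T ⊆ box 3 (2 ^ (k + 1)) \ box 3 (2 ^ k) → ∑ u ∈ F, screening n T (deepSource k j u) (dn (2 ^ (K + 3))) ≤ #F * (screening n T e₂ (dn (2 ^ (K + 3))) + μ / 2)) ∧ (∀ᶠ K : ℕ in atTop, ∀ᶠ n : ℕ in atTop, ∀ T : Finset (Site 3), T ⊆ box 3 n \ box 3 (2 ^ K) → dn (2 ^ (K + 3)) ∉ T → ∑ u ∈ F, screening n T (deepSource K j u) (dn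 (2 ^ (K + 3))) ≤ #F * (screening n T e₂ (dn (2 ^ (K + 3))) + μ / 2)))
    (hM : ∀ ε : ℝ, 0 < ε → ∃ A : ℕ, ∀ᶠ k : ℕ in atTop, ∀ K K' : ℕ, k + A ≤ K → k + A ≤ K' → ∀ᶠ n : ℕ in atTop, ∀ f : Finset (Site 3) → ℝ, (∀ C, 0 ≤ f C) → (∀ C, f C ≤ 1) → ∫ ω, f (innerCluster (2 ^ (k + 1)) 0 ω) ∂(sourcedDoubleCurrentLaw 3 n (criticalBeta 3) ({0} ∆ {up (2 ^ (K' + 3))}) ∅) ≤ ∫ ω, f (innerCluster (2 ^ (k + 1)) 0 ω) ∂(sourcedDoubleCurrentLaw 3 n (criticalBeta 3) ({0} ∆ {up (2 ^ (K + 3))}) ∅) + ε)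
    (hO : ∀ ε : ℝ, 0 < ε → ∀ c : ℕ, ∃ A : ℕ, ∀ᶠ k : ℕ in atTop, ∀ K K' : ℕ, k + A ≤ K → k + A ≤ K' → ∀ᶠ n : ℕ in atTop, ∀ T : Finset (Site 3), T ⊆ box 3 (2 ^ (k + 1)) \ box 3 (2 ^ k) → ∀ a ∈ box 3 (2 ^ (k + c)) \ T, screening n T a (dn (2 ^ (K' + 3))) ≤ screening n T a (dn (2 ^ (K + 3))) + ε) :
    Summit.CriticalPhenomena.Ising3DConformalLimit.Theses.EnergyNotSigmaSquared.GapForcesFarMerging :=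
  gapForcesFarMerging_of_annular' (annularDomination_of_blocking_untilt hB hH) (nearSource_of_screeningOscillation hNS)
    (farSource_of_strandMixing_probeOscillation hM hO)

/-- The crux is literally `EnergyGapPowerLaw → FarMergingShape cc2 (criticalCorr 3 4)`. [folklore] -/
theorem crux_iff_v33 :
    Summit.CriticalPhenomena.Ising3DConformalLimit.Theses.EnergyNotSigmaSquared.GapForcesFarMerging ↔
      (EnergyGapPowerLaw → FarMergingShape cc2 (criticalCorr 3 4)) := Iff.rfl

end Summit.CriticalPhenomena.Ising3DConformalLimit.Cruxes.GapForcesFarMerging.ScreeningFormLemmaA1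

end
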